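import Literature.Probability.Percolation.SlabRSWGluingHighProbExt
import HarnessLib

/-!
# Newman–Tassion–Wu 2017, Prop. 3.9 (3.28): the two-domain planar crossing for a right extension

Topic: `Literature/Probability/Percolation`. The geometric input of `GlueData.mem_evNear_of_cross₂`
(`SlabRSWGluingNearOfCross.lean`) for the first gluing of the proof of Prop. 3.9 (1) ((3.28): `Γ`
crosses the square `S = [0,n]²` from its bottom to its top, the long crossing of `R = [0,n+κn]×[0,n]`
runs from the right side of `R` to its left side): in `S = [a,b]×[c,d] ⊆ R = [a,b']×[c,d]` every
planar walk in `S` from the bottom row to the top row meets every planar walk in `R` from the column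
`x = b'` to the column `x = a` — the final portion of the latter after its last visit to `{x ≥ b}` is a
crossing of `S` between its vertical sides, and the tree's `planarCrossing_rect` applies.

* `NTW17.cross₂_of_rightExt`.

## Sources

* C. M. Newman, V. Tassion, W. Wu, *Critical percolation and the minimal spanning tree in slabs*,
  Comm. Pure Appl. Math. 70 (2017), arXiv:1512.09107: proof of Proposition 3.9, (3.27)–(3.29)
  [NewmanTassionWu2017].
-/

noncomputable section

namespace Literature.Probability.Percolation

open MeasureTheory LatticeModels SimpleGraph

namespace NTW17

/-- **The two-domain planar crossing for a right extension** (NTW, proof of Prop. 3.9 (3.28): "by the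
gluing lemma … in `R`"): in `S = [a,b]×[c,d] ⊆ R = [a,b']×[c,d]`, every planar walk in `S` from the
bottom row to the top row meets every planar walk in `R` from the column `x = b'` to the column `x = a`
(the latter's final portion after its last visit to `{x ≥ b}` is a right-left crossing of `S`).
[cite: NewmanTassionWu2017, Proposition 3.9 (proof, (3.28))] -/
theorem cross₂_of_rightExt {a b b' c d : ℤ} (hab : a < b) (hbb' : b ≤ b') {A B C Dd : Set (ℤ × ℤ)}
    (hA : ∀ z ∈ A, z.2 = c) (hB : ∀ z ∈ B, z.2 = d) (hC : ∀ z ∈ C, z.1 = b') (hD : ∀ z ∈ Dd, z.1 = a) :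
    ∀ (l₁ l₂ : List (ℤ × ℤ)) (h₁ : l₁ ≠ []) (h₂ : l₂ ≠ []), IsPlanarWalk l₁ → IsPlanarWalk l₂ →
      (∀ z ∈ l₁, z ∈ boxR a b c d) → (∀ z ∈ l₂, z ∈ boxR a b' c d) → l₁.head h₁ ∈ A → l₁.getLast h₁ ∈ B →
      l₂.head h₂ ∈ C → l₂.getLast h₂ ∈ Dd → ∃ z ∈ l₁, z ∈ l₂ := by
  intro l₁ l₂ h₁ h₂ hw₁ hw₂ hS₁ hS₂ hhA hlB hhC hlD
  -- the last vertex of `l₂` with `x ≥ b`: first such vertex of the reversed list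
  have hrev : ∃ x ∈ l₂.reverse, b ≤ x.1 :=
    ⟨l₂.head h₂, by simp [List.head_mem h₂], by rw [hC _ hhC]; exact hbb'⟩
  obtain ⟨m₁, x, m₂, hmeq, hxb, hm₁⟩ := exists_first_split (p := fun z : ℤ × ℤ => b ≤ z.1) l₂.reverse hrev
  have hl₂eq : l₂ = m₂.reverse ++ x :: m₁.reverse := by
    have := congrArg List.reverse hmeq
    simpa using this
  -- the suffix `x :: m₁.reverse`
  set suf := x :: m₁.reverse with hsuf
  have hsufsub : ∀ z ∈ suf, z ∈ l₂ := by
    intro z hz; rw [hl₂eq]; exact List.mem_append_right _ hz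
  have hwsuf : IsPlanarWalk suf := by
    have hw : IsPlanarWalk (m₂.reverse ++ suf) := by rw [hsuf, ← hl₂eq]; exact hw₂
    exact (List.isChain_append.1 hw).2.1
  have hlast : suf.getLast (by simp [hsuf]) = l₂.getLast h₂ := by
    rw [List.getLast_congr _ (by simp [hsuf]) hl₂eq]
    simp [hsuf]
  -- `m₁ ≠ []`: the last vertex of `l₂` is on the column `a < b`
  have hm₁ne : m₁ ≠ [] := by
    intro hm
    have : suf.getLast (by simp [hsuf]) = x := by simp [hsuf, hm]
    rw [hlast] at this
    have h1 := hD _ hlD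
    rw [this] at h1
    omega
  -- `x.1 = b`: the next vertex has `x`-coordinate `< b` and is a planar neighbour
  have hxeq : x.1 = b := by
    obtain ⟨y, ys, hys⟩ := List.exists_cons_of_ne_nil (show m₁.reverse ≠ [] by simpa using hm₁ne)
    have hy : ¬b ≤ y.1 := hm₁ y (by rw [← List.mem_reverse, hys]; simp)
    have hstep : x = y ∨ planarAdj x y := by
      have : IsPlanarWalk (x :: y :: ys) := by rw [hsuf, hys] at hwsuf; exact hwsuf
      exact (List.isChain_cons_cons.1 this).1
    rcases hstep with rfl | h
    · exact absurd hxb hy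
    · obtain ⟨x1, x2⟩ := x; obtain ⟨y1, y2⟩ := y
      simp only [planarAdj, Prod.mk_add_mk, Prod.mk.injEq, add_zero] at h
      simp only at hxb hy ⊢
      omega
  -- the suffix lies in `S`
  have hsufS : ∀ z ∈ suf, z ∈ boxR a b c d := by
    intro z hz
    have hzR := hS₂ z (hsufsub z hz)
    rw [mem_boxR_iff] at hzR ⊢
    rw [hsuf, List.mem_cons] at hz
    rcases hz with rfl | hz
    · omega
    · have : ¬b ≤ z.1 := hm₁ z (by rw [← List.mem_reverse]; exact hz)
      omega
  -- reverse the suffix: a planar walk in `S` from the column `a` to the column `b`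
  have hwrev : IsPlanarWalk suf.reverse := by
    rw [IsPlanarWalk, List.isChain_reverse]
    refine hwsuf.imp fun p q h => ?_
    rcases h with h | h
    · exact Or.inl h.symm
    · exact Or.inr (planarAdj_symm h)
  have hne : suf.reverse ≠ [] := by simp [hsuf]
  have hhead' : (suf.reverse.head hne).1 = a := by
    rw [List.head_reverse, hlast]; exact hD _ hlD
  have hlast' : (suf.reverse.getLast hne).1 = b := by
    rw [List.getLast_reverse]; simpa [hsuf] using hxeq
  obtain ⟨z, hz₁, hz₂⟩ := planarCrossing_rect (A := {z | z.1 = a}) (B := {z | z.1 = b}) (C := A) (D := B)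
    (fun z hz => hz) (fun z hz => hz) hA hB suf.reverse l₁ hne h₁ hwrev hw₁
    (fun z hz => hsufS z (List.mem_reverse.1 hz)) hS₁ hhead' hlast' hhA hlB
  exact ⟨z, hz₂, hsufsub z (List.mem_reverse.1 hz₁)⟩

end NTW17

end Literature.Probability.Percolation

end
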